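import Summits.ValiantsHypothesis.ValiantsHypothesis.Theorems.LacunarySymmetroidMatrixDescartesCensusNewtonCone

/-!
# `MatrixDescartes` census — THEOREM L-N (b) in the kernel: the `s = 1` rungs of CONJECTURE L on Newton-good windows

HONEST FRAMING.  Object-search cell `pub-symmetroid`, route crux `Theses.LacunarySymmetroid.MatrixDescartes`
(ledger item stmt-ValiantsHypothesis-18050).  ONE theorem, the kernel form of part (b) of engine-1 g14's
**THEOREM L-N** (memo `HOME/engine-1/g14/l18n/THEOREM-LN-E1G14.md` §2(b); READER PASS theory-2 g14, bus R922), stated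
for an ARBITRARY Descartes-sharp real fewnomial whose window has the class-G gap pattern:

`newton_s1_window`: let `f = Σ_{t<n} c_t X^{e_t}` (`n ≥ 5`, `e` strictly increasing, all `c_t ≠ 0`) have at least
`n − 1` distinct positive roots, and suppose the EQUAL-GAP condition `e₁ − e₀ = e₃ − e₂` (for the door-B window
`W = (d₁, d₂, 2d₁, d₁+d₂, 2d₂, …)` both gaps are `d₂ − d₁`).  With `π_t := ∏_{u≠t} |e_t − e_u|` and `u_t := |c_t|`:
if `π₁π₂ ≤ π₀π₃` («`R_W ≥ 1`», a support-only condition) then `u₀²u₄ + u₁²u₂ − u₀u₁u₃ > 0` — in the cell's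
1-indexed window notation `Φ⁰ = u₁²u₅ + u₂²u₃ − u₁u₂u₄ > 0`, i.e. the rung `L_(1,·)` of CONJECTURE L(d) holds at every
configuration of that window.  PROOF (the memo's two lines): the tree's Newton cone `Census.newton_cone` (C25) at the
consecutive triples `(0,1,2)` and `(1,2,3)` gives `A₀^γ A₂^δ ≤ A₁^{γ+δ}` and `A₁^δ A₃^γ ≤ A₂^{γ+δ}` for
`A_t = u_t π_t`, `δ = e₁−e₀ = e₃−e₂`, `γ = e₂−e₁`; multiplying and cancelling, `(A₀A₃)^γ ≤ (A₁A₂)^γ`, so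
`u₀u₃π₀π₃ ≤ u₁u₂π₁π₂ ≤ u₁u₂π₀π₃`, hence `u₀u₃ ≤ u₁u₂` and `Φ⁰ = u₁(u₁u₂ − u₀u₃) + u₀²u₄ ≥ u₀²u₄ > 0`.
Companion of `…CensusLaguerreL18.lean` (THEOREM L18-LAGUERRE(4): the bottom rung on EVERY class-G support, no
Newton-good hypothesis).  Nothing here bears on CONJECTURE L(d) as a whole (the `s = 0` rungs), on door B, on
`ζ_sym`, `DoorA26` / `DoorA34`, the crux, or `VP ≠ VNP`.

[folklore] — the cell's own elementary theorem on top of the kernel C25 (`newton_cone`).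
-/

-- `Summit.ValiantsHypothesis.ValiantsHypothesis.…` repeats a component by the D-0017 layout
-- (single-conjunct summit), which the `dupNamespace` linter flags; the name is mandated.
set_option linter.dupNamespace false

namespace Summit.ValiantsHypothesis.ValiantsHypothesis.Theorems.LacunarySymmetroidMatrixDescartes.Census

open Polynomial Finset
open scoped BigOperators Polynomial

/-- **THEOREM L-N (b) (kernel): the `s = 1` rung inequality on a Newton-good window.**  For a Descartes-sharp
real fewnomial `Σ_{t<n} c_t X^{e_t}` (`e` strictly increasing, `n ≥ 5`, all `c_t ≠ 0`, at least `n − 1` distinct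
positive roots) with equal gaps `e₁ − e₀ = e₃ − e₂` and `π₁π₂ ≤ π₀π₃` (`π_t = ∏_{u≠t}|e_t − e_u|`):
`0 < |c₀|²|c₄| + |c₁|²|c₂| − |c₀||c₁||c₃|`.  (engine-1 g14 THEOREM L-N (b), READER PASS theory-2 g14.) [folklore] -/
theorem newton_s1_window {n : ℕ} (hn : 5 ≤ n) (e : Fin n → ℕ) (he : StrictMono e) (c : Fin n → ℝ)
    (hc : ∀ t, c t ≠ 0)
    (hZ : n ≤ ((∑ t, C (c t) * X ^ (e t)).roots.toFinset.filter (fun x => 0 < x)).card + 1)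
    (hgap : e ⟨1, by omega⟩ - e ⟨0, by omega⟩ = e ⟨3, by omega⟩ - e ⟨2, by omega⟩)
    (hπ : (∏ u ∈ univ.erase (⟨1, by omega⟩ : Fin n), |((e ⟨1, by omega⟩ : ℕ) : ℝ) - e u|) *
            (∏ u ∈ univ.erase (⟨2, by omega⟩ : Fin n), |((e ⟨2, by omega⟩ : ℕ) : ℝ) - e u|)
          ≤ (∏ u ∈ univ.erase (⟨0, by omega⟩ : Fin n), |((e ⟨0, by omega⟩ : ℕ) : ℝ) - e u|) *
            (∏ u ∈ univ.erase (⟨3, by omega⟩ : Fin n), |((e ⟨3, by omega⟩ : ℕ) : ℝ) - e u|)) :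
    0 < |c ⟨0, by omega⟩| ^ 2 * |c ⟨4, by omega⟩| + |c ⟨1, by omega⟩| ^ 2 * |c ⟨2, by omega⟩|
        - |c ⟨0, by omega⟩| * |c ⟨1, by omega⟩| * |c ⟨3, by omega⟩| := by
  -- indices and the weights `A_t = |c_t| π_t`
  set i0 : Fin n := ⟨0, by omega⟩ with hi0
  set i1 : Fin n := ⟨1, by omega⟩ with hi1
  set i2 : Fin n := ⟨2, by omega⟩ with hi2
  set i3 : Fin n := ⟨3, by omega⟩ with hi3
  set i4 : Fin n := ⟨4, by omega⟩ with hi4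
  set π : Fin n → ℝ := fun t => ∏ u ∈ univ.erase t, |((e t : ℕ) : ℝ) - e u| with hπdef
  have hπpos : ∀ t, 0 < π t := by
    intro t
    refine Finset.prod_pos fun u hu => abs_pos.mpr (sub_ne_zero.mpr ?_)
    exact_mod_cast fun h => (Finset.mem_erase.mp hu).1 (he.injective h).symm
  have hApos : ∀ t, 0 < |c t| * π t := fun t => mul_pos (abs_pos.mpr (hc t)) (hπpos t)
  have h01 : i0 < i1 := Fin.mk_lt_mk.mpr (by norm_num)
  have h12 : i1 < i2 := Fin.mk_lt_mk.mpr (by norm_num)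
  have h23 : i2 < i3 := Fin.mk_lt_mk.mpr (by norm_num)
  have he01 : e i0 < e i1 := he h01
  have he12 : e i1 < e i2 := he h12
  have he23 : e i2 < e i3 := he h23
  -- gaps
  obtain ⟨δ, hδ⟩ : ∃ δ, e i1 = e i0 + δ := ⟨e i1 - e i0, by omega⟩
  obtain ⟨γ, hγ⟩ : ∃ γ, e i2 = e i1 + γ := ⟨e i2 - e i1, by omega⟩
  have hδ0 : 0 < δ := by omega
  have hγ0 : 0 < γ := by omega
  have hδ' : e i3 = e i2 + δ := by
    have : e i1 - e i0 = e i3 - e i2 := hgap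
    omega
  -- the two Newton-cone inequalities
  have hN1 := newton_cone e he c hZ h01 h12
  have hN2 := newton_cone e he c hZ h12 h23
  rw [show e i2 - e i1 = γ by omega, show e i1 - e i0 = δ by omega, show e i2 - e i0 = γ + δ by omega] at hN1
  rw [show e i3 - e i2 = δ by omega, show e i2 - e i1 = γ by omega, show e i3 - e i1 = γ + δ by omega] at hN2
  -- abbreviate
  set A0 := |c i0| * π i0 with hA0
  set A1 := |c i1| * π i1 with hA1
  set A2 := |c i2| * π i2 with hA2
  set A3 := |c i3| * π i3 with hA3
  have hA0p : 0 < A0 := hApos i0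
  have hA1p : 0 < A1 := hApos i1
  have hA2p : 0 < A2 := hApos i2
  have hA3p : 0 < A3 := hApos i3
  change A0 ^ γ * A2 ^ δ ≤ A1 ^ (γ + δ) at hN1
  change A1 ^ δ * A3 ^ γ ≤ A2 ^ (γ + δ) at hN2
  -- multiply and cancel: `(A0 A3)^γ ≤ (A1 A2)^γ`
  have hmul : (A0 ^ γ * A2 ^ δ) * (A1 ^ δ * A3 ^ γ) ≤ A1 ^ (γ + δ) * A2 ^ (γ + δ) :=
    mul_le_mul hN1 hN2 (by positivity) (by positivity)
  have hpow : (A0 * A3) ^ γ * (A1 ^ δ * A2 ^ δ) ≤ (A1 * A2) ^ γ * (A1 ^ δ * A2 ^ δ) := by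
    have e1 : (A0 ^ γ * A2 ^ δ) * (A1 ^ δ * A3 ^ γ) = (A0 * A3) ^ γ * (A1 ^ δ * A2 ^ δ) := by
      rw [mul_pow]; ring
    have e2 : A1 ^ (γ + δ) * A2 ^ (γ + δ) = (A1 * A2) ^ γ * (A1 ^ δ * A2 ^ δ) := by
      rw [pow_add, pow_add, mul_pow]; ring
    rw [← e1, ← e2]; exact hmul
  have hcancel : (A0 * A3) ^ γ ≤ (A1 * A2) ^ γ :=
    le_of_mul_le_mul_right hpow (by positivity)
  have hAA : A0 * A3 ≤ A1 * A2 :=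
    (pow_le_pow_iff_left₀ (by positivity) (by positivity) hγ0.ne').mp hcancel
  -- translate to the `|c|`'s with `π₁π₂ ≤ π₀π₃`
  have hπ' : π i1 * π i2 ≤ π i0 * π i3 := hπ
  have hcc : |c i0| * |c i3| * (π i0 * π i3) ≤ |c i1| * |c i2| * (π i0 * π i3) := by
    calc |c i0| * |c i3| * (π i0 * π i3) = A0 * A3 := by rw [hA0, hA3]; ring
      _ ≤ A1 * A2 := hAA
      _ = |c i1| * |c i2| * (π i1 * π i2) := by rw [hA1, hA2]; ring
      _ ≤ |c i1| * |c i2| * (π i0 * π i3) :=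
          mul_le_mul_of_nonneg_left hπ' (mul_nonneg (abs_nonneg _) (abs_nonneg _))
  have hkey : |c i0| * |c i3| ≤ |c i1| * |c i2| :=
    le_of_mul_le_mul_right hcc (mul_pos (hπpos i0) (hπpos i3))
  -- conclude: Φ⁰ = |c₁|(|c₁||c₂| − |c₀||c₃|) + |c₀|²|c₄| ≥ |c₀|²|c₄| > 0
  have h0 : 0 < |c i0| := abs_pos.mpr (hc i0)
  have h1 : 0 ≤ |c i1| := abs_nonneg _
  have h4 : 0 < |c i4| := abs_pos.mpr (hc i4)
  nlinarith [mul_nonneg h1 (sub_nonneg.mpr hkey), mul_pos (pow_pos h0 2) h4]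

end Summit.ValiantsHypothesis.ValiantsHypothesis.Theorems.LacunarySymmetroidMatrixDescartes.Census
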